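import Summits.QuantumFields.BalabanUV.T4Continuum.Support.NE3LocalReadouts
import Summits.QuantumFields.BalabanUV.T4Continuum.Support.NE3EnergySmallFieldCurl
import HarnessLib

/-!
# T⁴ programme, node NE3 — repair census G-ne3p1-g19-1, leaf (READOUT♯): THE SHARP LOCAL ACTION READ-OUT — the second
# variation of the window action along `V e^{tX}` is the SQUARED DRESSED CURL plus terms carrying the plaquette radius or two
# more powers of `X`

NE3 prover lineage P1, gen 19 (cell `pub-balaban`, unit `b2b-balaban-t4-ne3-p1`, row NE3 OWNER).  CONTEXT: the crude (D) route's
read-out `NE3LocalReadouts.abs_fineAction_vary_sub_le` bounds the second-order remainder by `(7/2)·Σ bondSq X p` — the bare `ℓ²`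
size of the direction.  In the η-weighted currency of the surviving variant (R3) (`NE3EnergyWeightedShapes.energyNormW`, where
`dirSq` carries the weight `L^{−2k}` and does not decay on its own) this is useless; what decays is the CURL.  THIS FILE proves the
sharp form (skeleton v1.9 §4b socket E-READOUT♯): for unitary `V` with `‖V(∂p) − 1‖ ≤ a` on the window `W`, skew `X` with
`‖X(b)‖ ≤ α`,
  `|A_W(V e^X) − A_W(V) − dAction V X W|`
  `  ≤ Σ_{p∈W} [ ‖(d_V X)(p)‖² + 144(e^α − 1)²·bondSq X p + (7/2)·(a + ‖(d_V X)(p)‖ + 24α(e^α − 1))·bondSq X p ]`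
— the squared dressed curl (its Hilbert–Schmidt density, `NE3HessBounds.hessPlaqAt_self_eq`), a `bondSq` term with the PLAQUETTE
RADIUS `a` (it vanishes at a flat plaquette), and `bondSq` terms carrying at least one more power of `X` through `‖d_V X‖ ≤ 2·bondL1`
or `e^α − 1` (cubic and higher).  Ingredients BY NAME: `hessPlaqAt_self_eq`, `norm_dcurlAt_self_le`, `norm_curlAt_sq_le`
(NE3HessBounds, P3), `NE3CurlStability.norm_curlAt_vary_sub_le` (the moving curl), `NE3EnergySmallFieldCurl.norm_hol_vary_sub_one_le_curl`
(the moving plaquette radius, leaf-03 g4), `T4ConvexResponse.taylor_lower`, `NE3HessForm.segment_derivData`.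

CONTENT (0 def, 0 sorry): §1 the Hessian density along the segment, above and below; §2 **`abs_fineAction_vary_sub_sub_dAction_le_sharp`**
and the read-out **`abs_fineAction_vary_sub_le_sharp`** (adds the first-order term `a·Σ‖d_V X‖`).

HONEST FRAMING.  Elementary matrix calculus on ONE window (our frame); nothing about minimisers, T-E∕T-E_w, (H∃) or NE3 is asserted;
NE3 NOT proved; spine 0∕9; finite T⁴ rung (B)+1 — NOT infinite volume, NOT mass gap, NOT Clay.  PLACEMENT: `Summits/QuantumFields/BalabanUV/`.
-/

set_option autoImplicit false

open scoped BigOperators Matrix Matrix.Norms.L2Operator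
open NormedSpace Finset Set

namespace Summit.QuantumFields.BalabanUV.T4Continuum.NE3LocalReadoutSharp

open Literature.MathematicalPhysics.QuantumFieldTheory.Balaban1983to89
open B7Prop1Explicit B7Prop2Explicit MatrixLog UnitaryModel MatrixNorms
open T4AveragingDeficitWall hiding Site Plane Plaq Bond
open T4ConvexResponse (taylor_lower)
open AveragingDeficitNearIdentity (abs_nReTr_mul_le)
open AveragingDeficitPlaqDeriv (vary_isUnitaryCfg)
open NE3HessForm
open NE3HessContinuity (bondL1At bondL1At_nonneg bondL1At_sq_le bondL1)
open NE3HessBounds (hessPlaqAt_self_eq norm_dcurlAt_self_le norm_curlAt_sq_le bondSqAt bondSq)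
open NE3CurlStability (norm_curlAt_vary_sub_le)
open NE3EnergySmallFieldCurl (norm_hol_vary_sub_one_le_curl)

noncomputable section

variable {d : ℕ} {n : Type*} [Fintype n] [DecidableEq n] [Nonempty n]

/-! ## §1 The Hessian density along the segment `t ↦ V e^{tX}`, `t ∈ [0,1]` -/

omit [Nonempty n] in
/-- `bondSqAt ≥ 0`. [folklore] -/
theorem bondSqAt_nonneg (X : Site d → Fin d → Matrix n n ℂ) (z : Site d) (μ ν : Fin d) : 0 ≤ bondSqAt X z μ ν := by
  unfold bondSqAt; positivity

/-- **THE MOVING HESSIAN DENSITY, FROM ABOVE**: for unitary `V`, skew `X` with `‖X(b)‖ ≤ α`, `t ∈ [0,1]`, and a plaquette with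
`‖V(∂p′) − 1‖ ≤ a`:
`hessPlaqAt (V e^{tX}) X X p′ ≤ 2‖(d_V X)(p′)‖² + 72(e^α − 1)²·bondL1² + 7·(a + ‖(d_V X)(p′)‖ + 24α(e^α − 1))·bondSq`. [folklore] -/
theorem hessPlaqAt_vary_le {V : Site d → Fin d → (Matrix n n ℂ)ˣ} (hV : IsUnitaryCfg V) {X : Site d → Fin d → Matrix n n ℂ}
    (hX : IsSkewDir X) {α : ℝ} (hXα : ∀ x κ, ‖X x κ‖ ≤ α) {t : ℝ} (ht0 : 0 ≤ t) (ht1 : t ≤ 1) (z : Site d) (μ ν : Fin d)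
    {a : ℝ} (ha : ‖((hol V z (plaqWord μ ν) : (Matrix n n ℂ)ˣ) : Matrix n n ℂ) - 1‖ ≤ a) :
    hessPlaqAt (vary V X t) X X z μ ν
      ≤ 2 * ‖curlAt V X z μ ν‖ ^ 2 + 72 * (Real.exp α - 1) ^ 2 * bondL1At X z μ ν ^ 2
        + 7 * (a + ‖curlAt V X z μ ν‖ + 24 * α * (Real.exp α - 1)) * bondSqAt X z μ ν := by
  have hVt : IsUnitaryCfg (vary V X t) := vary_isUnitaryCfg hV hX t
  have hα0 : 0 ≤ α := (norm_nonneg _).trans (hXα z μ)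
  set C0 := curlAt V X z μ ν
  set Ct := curlAt (vary V X t) X z μ ν
  set Dt := dcurlAt (vary V X t) X X z μ ν
  set Ht := ((hol (vary V X t) z (plaqWord μ ν) : (Matrix n n ℂ)ˣ) : Matrix n n ℂ)
  have hB := bondSqAt_nonneg X z μ ν
  have hL1 := bondL1At_nonneg X z μ ν
  -- the moving curl
  have hexp1 : Real.exp (|t| * α) - 1 ≤ Real.exp α - 1 := by
    rw [abs_of_nonneg ht0]
    have : t * α ≤ α := by nlinarith
    linarith [Real.exp_le_exp.mpr this]
  have hexp0 : 0 ≤ Real.exp α - 1 := by linarith [Real.add_one_le_exp α]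
  have hCt : ‖Ct‖ ≤ ‖C0‖ + 6 * (Real.exp α - 1) * bondL1At X z μ ν := by
    have h := norm_curlAt_vary_sub_le hV hX hXα t X z μ ν
    have h' : 6 * (Real.exp (|t| * α) - 1) * bondL1At X z μ ν ≤ 6 * (Real.exp α - 1) * bondL1At X z μ ν :=
      mul_le_mul_of_nonneg_right (by linarith) hL1
    calc ‖Ct‖ = ‖C0 + (Ct - C0)‖ := by rw [add_sub_cancel]
      _ ≤ ‖C0‖ + ‖Ct - C0‖ := norm_add_le _ _
      _ ≤ ‖C0‖ + 6 * (Real.exp α - 1) * bondL1At X z μ ν := by linarith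
  have hCt2 : ‖Ct‖ ^ 2 ≤ 2 * ‖C0‖ ^ 2 + 72 * (Real.exp α - 1) ^ 2 * bondL1At X z μ ν ^ 2 := by
    have h0 : 0 ≤ ‖Ct‖ := norm_nonneg _
    have h1 : 0 ≤ 6 * (Real.exp α - 1) * bondL1At X z μ ν := by positivity
    nlinarith [sq_nonneg (‖C0‖ - 6 * (Real.exp α - 1) * bondL1At X z μ ν)]
  -- the moving plaquette radius
  have hHt : ‖Ht - 1‖ ≤ a + ‖C0‖ + 24 * α * (Real.exp α - 1) := by
    have h := norm_hol_vary_sub_one_le_curl hV hX hXα ht0 z μ ν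
    have h2 : t * (‖C0‖ + 24 * α * (Real.exp (t * α) - 1)) ≤ ‖C0‖ + 24 * α * (Real.exp α - 1) := by
      have h3 : Real.exp (t * α) - 1 ≤ Real.exp α - 1 := by rw [← abs_of_nonneg ht0]; exact hexp1
      have h4 : 0 ≤ ‖C0‖ + 24 * α * (Real.exp (t * α) - 1) := by
        have : 0 ≤ Real.exp (t * α) - 1 := by linarith [Real.add_one_le_exp (t * α), mul_nonneg ht0 hα0]
        positivity
      calc t * (‖C0‖ + 24 * α * (Real.exp (t * α) - 1)) ≤ 1 * (‖C0‖ + 24 * α * (Real.exp (t * α) - 1)) :=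
            mul_le_mul_of_nonneg_right ht1 h4
        _ ≤ ‖C0‖ + 24 * α * (Real.exp α - 1) := by nlinarith
    linarith
  -- the exact split of the density
  rw [hessPlaqAt_self_eq hVt hX]
  have hnhs : nhsNormSq Ct ≤ ‖Ct‖ ^ 2 := nhsNormSq_le_opNorm_sq Ct
  have hrest : |nReTr ((Dt + Ct * Ct) * (Ht - 1))| ≤ 7 * bondSqAt X z μ ν * (a + ‖C0‖ + 24 * α * (Real.exp α - 1)) := by
    have h2 : |nReTr ((Dt + Ct * Ct) * (Ht - 1))| ≤ ‖Dt + Ct * Ct‖ * ‖Ht - 1‖ := abs_nReTr_mul_le _ _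
    have h3 : ‖Dt + Ct * Ct‖ ≤ 7 * bondSqAt X z μ ν := by
      refine (norm_add_le _ _).trans ?_
      have h4 := norm_dcurlAt_self_le hVt X z μ ν
      have h5 : ‖Ct * Ct‖ ≤ 4 * bondSqAt X z μ ν :=
        (opNorm_mul_le _ _).trans (by rw [← sq]; exact norm_curlAt_sq_le hVt X z μ ν)
      linarith
    exact h2.trans (mul_le_mul h3 hHt (norm_nonneg _) (by positivity))
  have := le_abs_self (nReTr ((Dt + Ct * Ct) * (Ht - 1)))
  have := neg_abs_le (nReTr ((Dt + Ct * Ct) * (Ht - 1)))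
  nlinarith

/-- **THE MOVING HESSIAN DENSITY, FROM BELOW**: under the same data,
`hessPlaqAt (V e^{tX}) X X p′ ≥ −7·(a + ‖(d_V X)(p′)‖ + 24α(e^α − 1))·bondSq` (the Hilbert–Schmidt square is dropped). [folklore] -/
theorem hessPlaqAt_vary_ge {V : Site d → Fin d → (Matrix n n ℂ)ˣ} (hV : IsUnitaryCfg V) {X : Site d → Fin d → Matrix n n ℂ}
    (hX : IsSkewDir X) {α : ℝ} (hXα : ∀ x κ, ‖X x κ‖ ≤ α) {t : ℝ} (ht0 : 0 ≤ t) (ht1 : t ≤ 1) (z : Site d) (μ ν : Fin d)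
    {a : ℝ} (ha : ‖((hol V z (plaqWord μ ν) : (Matrix n n ℂ)ˣ) : Matrix n n ℂ) - 1‖ ≤ a) :
    -(7 * (a + ‖curlAt V X z μ ν‖ + 24 * α * (Real.exp α - 1)) * bondSqAt X z μ ν)
      ≤ hessPlaqAt (vary V X t) X X z μ ν := by
  have hVt : IsUnitaryCfg (vary V X t) := vary_isUnitaryCfg hV hX t
  have hα0 : 0 ≤ α := (norm_nonneg _).trans (hXα z μ)
  set C0 := curlAt V X z μ ν
  set Ct := curlAt (vary V X t) X z μ ν
  set Dt := dcurlAt (vary V X t) X X z μ ν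
  set Ht := ((hol (vary V X t) z (plaqWord μ ν) : (Matrix n n ℂ)ˣ) : Matrix n n ℂ)
  have hB := bondSqAt_nonneg X z μ ν
  have hHt : ‖Ht - 1‖ ≤ a + ‖C0‖ + 24 * α * (Real.exp α - 1) := by
    have h := norm_hol_vary_sub_one_le_curl hV hX hXα ht0 z μ ν
    have h2 : t * (‖C0‖ + 24 * α * (Real.exp (t * α) - 1)) ≤ ‖C0‖ + 24 * α * (Real.exp α - 1) := by
      have h3 : Real.exp (t * α) - 1 ≤ Real.exp α - 1 := by
        have : t * α ≤ α := by nlinarith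
        linarith [Real.exp_le_exp.mpr this]
      have h4 : 0 ≤ ‖C0‖ + 24 * α * (Real.exp (t * α) - 1) := by
        have : 0 ≤ Real.exp (t * α) - 1 := by linarith [Real.add_one_le_exp (t * α), mul_nonneg ht0 hα0]
        positivity
      calc t * (‖C0‖ + 24 * α * (Real.exp (t * α) - 1)) ≤ 1 * (‖C0‖ + 24 * α * (Real.exp (t * α) - 1)) :=
            mul_le_mul_of_nonneg_right ht1 h4
        _ ≤ ‖C0‖ + 24 * α * (Real.exp α - 1) := by nlinarith
    linarith
  rw [hessPlaqAt_self_eq hVt hX]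
  have hnhs : 0 ≤ nhsNormSq Ct := nhsNormSq_nonneg Ct
  have hrest : |nReTr ((Dt + Ct * Ct) * (Ht - 1))| ≤ 7 * bondSqAt X z μ ν * (a + ‖C0‖ + 24 * α * (Real.exp α - 1)) := by
    have h2 : |nReTr ((Dt + Ct * Ct) * (Ht - 1))| ≤ ‖Dt + Ct * Ct‖ * ‖Ht - 1‖ := abs_nReTr_mul_le _ _
    have h3 : ‖Dt + Ct * Ct‖ ≤ 7 * bondSqAt X z μ ν := by
      refine (norm_add_le _ _).trans ?_
      have h4 := norm_dcurlAt_self_le hVt X z μ ν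
      have h5 : ‖Ct * Ct‖ ≤ 4 * bondSqAt X z μ ν :=
        (opNorm_mul_le _ _).trans (by rw [← sq]; exact norm_curlAt_sq_le hVt X z μ ν)
      linarith
    exact h2.trans (mul_le_mul h3 hHt (norm_nonneg _) (by positivity))
  have := le_abs_self (nReTr ((Dt + Ct * Ct) * (Ht - 1)))
  nlinarith

/-! ## §2 The sharp second-order read-out on a window -/

/-- **READOUT♯ — THE ACTION ALONG THE UNIT SEGMENT TO SECOND ORDER, SHARP FORM**: for unitary `V` with `‖V(∂p) − 1‖ ≤ a` on the
window `W`, skew `X` with `‖X(b)‖ ≤ α`: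
`|A_W(V e^X) − A_W(V) − dAction V X W| ≤ Σ_{p∈W} [‖(d_V X)(p)‖² + 36(e^α − 1)²·bondL1 X p² + (7/2)(a + ‖(d_V X)(p)‖ + 24α(e^α − 1))·bondSq X p]`
— squared dressed curl + (plaquette radius) × bondSq + (one more power of X) × bondSq.  (Compare `NE3LocalReadouts`: `(7/2)·Σ bondSq`.)
[folklore] -/
theorem abs_fineAction_vary_sub_sub_dAction_le_sharp {V : Site d → Fin d → (Matrix n n ℂ)ˣ} (hV : IsUnitaryCfg V)
    {X : Site d → Fin d → Matrix n n ℂ} (hX : IsSkewDir X) {α : ℝ} (hXα : ∀ x κ, ‖X x κ‖ ≤ α)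
    (W : Finset (T4AveragingDeficitWall.Plaq d)) {a : ℝ}
    (ha : ∀ p ∈ W, ‖((fhol V p : (Matrix n n ℂ)ˣ) : Matrix n n ℂ) - 1‖ ≤ a) :
    |fineAction (vary V X 1) W - fineAction V W - dAction V X W|
      ≤ ∑ p ∈ W, (‖curl V X p‖ ^ 2 + 36 * (Real.exp α - 1) ^ 2 * bondL1 X p ^ 2
          + 7 / 2 * (a + ‖curl V X p‖ + 24 * α * (Real.exp α - 1)) * bondSq X p) := by
  obtain ⟨h1, h2⟩ := segment_derivData V X W
  -- uniform bounds of the second derivative along the segment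
  set Mup : ℝ := ∑ p ∈ W, (2 * ‖curl V X p‖ ^ 2 + 72 * (Real.exp α - 1) ^ 2 * bondL1 X p ^ 2
      + 7 * (a + ‖curl V X p‖ + 24 * α * (Real.exp α - 1)) * bondSq X p) with hMup
  set Mlo : ℝ := ∑ p ∈ W, 7 * (a + ‖curl V X p‖ + 24 * α * (Real.exp α - 1)) * bondSq X p with hMlo
  have hup : ∀ t ∈ Icc (0 : ℝ) 1, hess (vary V X t) X X W ≤ Mup := by
    intro t ht
    unfold hess
    exact sum_le_sum fun p hp => hessPlaqAt_vary_le hV hX hXα ht.1 ht.2 p.1 p.2.1.1 p.2.1.2 (ha p hp)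
  have hlo : ∀ t ∈ Icc (0 : ℝ) 1, -Mlo ≤ hess (vary V X t) X X W := by
    intro t ht
    unfold hess
    rw [hMlo, ← sum_neg_distrib]
    exact sum_le_sum fun p hp => hessPlaqAt_vary_ge hV hX hXα ht.1 ht.2 p.1 p.2.1.1 p.2.1.2 (ha p hp)
  -- lower Taylor bound for the action, and for MINUS the action
  have lo := taylor_lower h1 h2 hlo
  have h1' : ∀ t ∈ Icc (0 : ℝ) 1,
      HasDerivAt (fun s : ℝ => -fineAction (vary V X s) W) (-dAction (vary V X t) X W) t := fun t ht => (h1 t ht).neg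
  have h2' : ∀ t ∈ Icc (0 : ℝ) 1,
      HasDerivAt (fun s : ℝ => -dAction (vary V X s) X W) (-hess (vary V X t) X X W) t := fun t ht => (h2 t ht).neg
  have hup' : ∀ t ∈ Icc (0 : ℝ) 1, -Mup ≤ -hess (vary V X t) X X W := fun t ht => by linarith [hup t ht]
  have up := taylor_lower h1' h2' hup'
  have hv0 : vary V X 0 = V := by
    funext x κ; simp [vary]
  rw [hv0] at lo up
  have hsum : ∑ p ∈ W, (‖curl V X p‖ ^ 2 + 36 * (Real.exp α - 1) ^ 2 * bondL1 X p ^ 2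
      + 7 / 2 * (a + ‖curl V X p‖ + 24 * α * (Real.exp α - 1)) * bondSq X p) = Mup / 2 := by
    rw [hMup, sum_div]
    exact sum_congr rfl fun p _ => by ring
  have hMlo_le : Mlo ≤ Mup := by
    rw [hMlo, hMup]
    refine sum_le_sum fun p _ => ?_
    have : 0 ≤ 2 * ‖curl V X p‖ ^ 2 + 72 * (Real.exp α - 1) ^ 2 * bondL1 X p ^ 2 := by positivity
    linarith
  rw [hsum, abs_le]
  constructor <;> linarith

/-- **THE SHARP LOCAL READ-OUT** (skeleton v1.9 §4b, E-READOUT♯): adds the first-order term `|dAction V X W| ≤ a·Σ‖(d_V X)(p)‖`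
(`NE3LocalReadouts`, the first variation at a flat plaquette of a skew insertion has zero real trace):
`|A_W(V e^X) − A_W(V)| ≤ a·Σ_W ‖d_V X‖ + Σ_W [‖d_V X‖² + 36(e^α−1)² bondL1² + (7/2)(a + ‖d_V X‖ + 24α(e^α−1))·bondSq]`. [folklore] -/
theorem abs_fineAction_vary_sub_le_sharp {V : Site d → Fin d → (Matrix n n ℂ)ˣ} (hV : IsUnitaryCfg V)
    {X : Site d → Fin d → Matrix n n ℂ} (hX : IsSkewDir X) {α : ℝ} (hXα : ∀ x κ, ‖X x κ‖ ≤ α)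
    (W : Finset (T4AveragingDeficitWall.Plaq d)) {a : ℝ}
    (ha : ∀ p ∈ W, ‖((fhol V p : (Matrix n n ℂ)ˣ) : Matrix n n ℂ) - 1‖ ≤ a) :
    |fineAction (vary V X 1) W - fineAction V W|
      ≤ a * ∑ p ∈ W, ‖curl V X p‖
        + ∑ p ∈ W, (‖curl V X p‖ ^ 2 + 36 * (Real.exp α - 1) ^ 2 * bondL1 X p ^ 2
          + 7 / 2 * (a + ‖curl V X p‖ + 24 * α * (Real.exp α - 1)) * bondSq X p) := by
  have h2 := abs_fineAction_vary_sub_sub_dAction_le_sharp hV hX hXα W ha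
  have h1 : |dAction V X W| ≤ a * ∑ p ∈ W, ‖curl V X p‖ := by
    unfold dAction
    rw [abs_neg]
    exact NE3EnergySource.abs_sum_nReTr_curl_fhol_le hV hX W ha
  have e : fineAction (vary V X 1) W - fineAction V W
      = (fineAction (vary V X 1) W - fineAction V W - dAction V X W) + dAction V X W := by ring
  rw [e]
  exact (abs_add_le _ _).trans (by linarith)

end

end Summit.QuantumFields.BalabanUV.T4Continuum.NE3LocalReadoutSharp
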